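import Mathlib
import Literature.NumberTheory.Transcendental.AssociatorsCocycleVanishingProofs
import HarnessLib

/-!
# Associators XV: the pentagon equation implies the hexagon equations [Furusho2010, Thm 1]

Final proofs file: the discharge `furusho_pentagon_hexagon_holds` of the named fact
`furusho_pentagon_hexagon` (`Associators.lean`), i.e. [Furusho2010, Thm 1]: for a group-like
solution `φ ∈ k⟨⟨X₀,X₁⟩⟩` of Drinfeld's pentagon equation over a field `k` of characteristic `0`
and `μ = ±(24 c_{X₀X₁}(φ))^{1/2} ∈ k̄`, the pair `(μ, φ)` satisfies both hexagon equations.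

The argument formalised in this series of files is an elementary inductive one (in place of the
Grothendieck–Teichmüller-torsor arguments of [Furusho2010, §2] and of Bar-Natan–Dancso, which use
the existence of associators): by induction on the level `m`, the first hexagon holds in
`U𝔞₄ ⊗ k/(deg > m)`.
* `m ≤ 2`: direct computation, where `μ² = 24 c₂(φ)` enters (`AssociatorsLowDegreeProofs`).
* `m ≥ 3`: the defect series `Ψ = 𝒢 - ℰ` of the hexagon (`AssociatorsDefectSeriesProofs`) has no
  terms of degree `< m` by induction; the pentagon ALONE gives the coherence identity for a strand
  moving over a block of three (`AssociatorsCoherenceProofs`), which at level `m` reduces to the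
  2-cocycle identity `Ψ(x₀+x₁,x₂) + Ψ(x₀,x₁) = Ψ(x₀,x₁+x₂) + Ψ(x₁,x₂)` for `Ψ` in the free algebra on
  the chords through the moving strand (`AssociatorsCocycleProofs`); such cocycles of degree
  `m ≥ 3` are multiples of `(x+y)^m - x^m - y^m`, and the degree-`m` part of `Ψ` is primitive
  (difference of two group-like series agreeing below degree `m`), so it vanishes
  (`AssociatorsCocycleVanishingProofs`); hence the hexagon holds at level `m`
  (`NCSeries.hexAt_of_forall_lt`).
The second hexagon for `μ` is the image of the first hexagon for `-μ` (same `μ²`) under the strand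
permutation `(0 1 2)` followed by inversion (`NCSeries.hexBAt_of_hexAt_neg`), and `μ` with
`μ² = 24 c₂(φ)` exists in `k̄` (`IsAlgClosed.exists_pow_nat_eq`).

No named facts are introduced; `furusho_pentagon_hexagon_holds` closes the fact.

## References

* H. Furusho, *Pentagon and hexagon equations*, Ann. of Math. 171 (2010), 545–556, Thm 1.
  [Furusho2010]
* D. Bar-Natan, Z. Dancso, *Pentagon and hexagon equations following Furusho*, Proc. AMS 140
  (2012), §3 (minimal-degree induction). [BarnatanDancso2011]
-/

noncomputable section

open scoped BigOperators

namespace Literature.NumberTheory.Transcendental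

universe u

namespace NCSeries

section Induction

variable {k : Type u} [CommRing k] [Algebra ℚ k]

local notation "𝔱" m => (DrinfeldKohnoTrunc.t k m : Fin 4 → Fin 4 → DrinfeldKohnoTrunc k (Fin 4) m)

/-- **The inductive step** (cocycle argument, towards [Furusho2010, Thm 1]): for a group-like
solution `φ` of the pentagon and any `μ`, if the first hexagon holds at all levels `< m` with
`m ≥ 3`, it holds at level `m`: the defect series has no terms below degree `m` (induction), its
degree-`m` part is primitive and satisfies the cocycle identity, hence vanishes. [folklore] -/
theorem hexAt_of_forall_lt {φ : NCSeries Bool k} (hg : IsGroupLike φ) (hP : DrinfeldPentagon φ)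
    (μ : k) {m : ℕ} (hm : 3 ≤ m) (hH : ∀ n : ℕ, n < m → HexAt μ φ n) : HexAt μ φ m := by
  have h0 : φ [false] = 0 := hP.apply_letter_eq_zero_of_isGroupLike hg false
  have h1 : φ [true] = 0 := hP.apply_letter_eq_zero_of_isGroupLike hg true
  have h2 := hP.two_cycle hg
  have hlow : ∀ w : List Bool, w.length < m → hexDefect μ φ w = 0 := fun w hw =>
    hexDefect_apply_eq_zero_of_forall_lt hg h0 h1 h2 hH hw
  have hprim : IsPrimitive (degPart m (hexDefect μ φ)) := by
    show IsPrimitive (degPart m (hexG μ φ - hexE μ))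
    exact isPrimitive_degPart_sub (isGroupLike_hexE μ) (isGroupLike_hexG μ hg) fun w hw => by
      have h := hlow w hw
      rw [hexDefect_apply, sub_eq_zero] at h
      exact h.symm
  have htop : ∀ w : List Bool, w.length = m → hexDefect μ φ w = 0 := fun w hw =>
    apply_eq_zero_of_cocycle_of_isPrimitive hm (cocycle_free hg hP μ hH) hprim hw
  rw [hexAt_iff_evalTrunc_hexDefect hg h0 h1 h2 μ]
  refine evalTrunc_eq_zero_of_mem_truncIdeal m _ (mem_truncIdeal.mpr fun w hw => ?_)
  rcases Nat.lt_or_ge w.length m with h | h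
  · exact hlow w h
  · exact htop w (le_antisymm hw h)

/-- **The first hexagon at every level** from the pentagon, for `μ² = 24 c₂(φ)`.
[cite: Furusho2010, Thm 1] -/
theorem hexAt_of_pentagon {φ : NCSeries Bool k} (hg : IsGroupLike φ) (hP : DrinfeldPentagon φ) {μ : k}
    (hμ : μ ^ 2 = 24 * φ [false, true]) (N : ℕ) : HexAt μ φ N := by
  have h0 : φ [false] = 0 := hP.apply_letter_eq_zero_of_isGroupLike hg false
  have h1 : φ [true] = 0 := hP.apply_letter_eq_zero_of_isGroupLike hg true
  induction N using Nat.strong_induction_on with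
  | _ N ih =>
    by_cases hN : N ≤ 2
    · exact (hexAt_and_hexBAt_of_le_two hg h0 h1 hμ hN).1
    · exact hexAt_of_forall_lt hg hP μ (by omega) ih

/-- The value of the inverse of the unit `e^{μx/2}`. [folklore] -/
@[simp] theorem expU_inv_val {N : ℕ} (μ : k) (x : DrinfeldKohnoTrunc k (Fin 4) N)
    (hx : x ∈ (DrinfeldKohnoTrunc.genSpan : Submodule k (DrinfeldKohnoTrunc k (Fin 4) N))) :
    ((expU μ x hx)⁻¹ : (DrinfeldKohnoTrunc k (Fin 4) N)ˣ) =
      (DrinfeldKohnoTrunc.expT (-(((1 / 2 : ℚ) • μ) • x)) : DrinfeldKohnoTrunc k (Fin 4) N) :=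
  rfl

omit [Algebra ℚ k] in
/-- The value of the inverse of the unit `φ(a, b)`. [folklore] -/
theorem phiU_inv_val {N : ℕ} {φ : NCSeries Bool k} (h1 : φ [] = 1)
    {a b : DrinfeldKohnoTrunc k (Fin 4) N}
    (ha : a ∈ (DrinfeldKohnoTrunc.genSpan : Submodule k (DrinfeldKohnoTrunc k (Fin 4) N)))
    (hb : b ∈ (DrinfeldKohnoTrunc.genSpan : Submodule k (DrinfeldKohnoTrunc k (Fin 4) N))) :
    ((phiU N φ a b)⁻¹ : (DrinfeldKohnoTrunc k (Fin 4) N)ˣ) =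
      (Ring.inverse (evalTrunc N (bsub a b) φ) : DrinfeldKohnoTrunc k (Fin 4) N) := by
  rw [← phiU_val h1 ha hb]
  exact (Ring.inverse_unit _).symm

/-- The cyclic permutation `0 ↦ 1 ↦ 2 ↦ 0` of the first three strands. [folklore] -/
def ρ₀₁₂ : Equiv.Perm (Fin 4) := ⟨![1, 2, 0, 3], ![2, 0, 1, 3], by decide, by decide⟩

/-- Values of `ρ₀₁₂`. [folklore] -/
@[simp] theorem ρ₀₁₂_0 : ρ₀₁₂ 0 = 1 := rfl
/-- Values of `ρ₀₁₂`. [folklore] -/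
@[simp] theorem ρ₀₁₂_1 : ρ₀₁₂ 1 = 2 := rfl
/-- Values of `ρ₀₁₂`. [folklore] -/
@[simp] theorem ρ₀₁₂_2 : ρ₀₁₂ 2 = 0 := rfl

/-- **The second hexagon for `μ` from the first hexagon for `-μ`**: apply the strand
permutation `(0 1 2)` to the first hexagon for `(-μ, φ)` and invert both sides (all factors are
units for `c_∅(φ) = 1`); cf. [Furusho2010, Lemma 7] (the two hexagons as the two projections of
one relation). [folklore] -/
theorem hexBAt_of_hexAt_neg {φ : NCSeries Bool k} (h1 : φ [] = 1) {μ : k} {N : ℕ}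
    (hH : HexAt (-μ) φ N) : HexBAt μ φ N := by
  -- memberships
  have m01 := DrinfeldKohnoTrunc.t_mem_genSpan (R := k) (N := N) (0 : Fin 4) 1
  have m02 := DrinfeldKohnoTrunc.t_mem_genSpan (R := k) (N := N) (0 : Fin 4) 2
  have m12 := DrinfeldKohnoTrunc.t_mem_genSpan (R := k) (N := N) (1 : Fin 4) 2
  have m0102 := DrinfeldKohnoTrunc.t_add_t_mem_genSpan (R := k) (N := N) 0 1 0 2
  have hu : IsUnit (evalTrunc N (bsub ((𝔱 N) 0 2) ((𝔱 N) 1 2)) φ) := isUnit_subst₂ h1 m02 m12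
  -- the permuted first hexagon for `-μ`
  unfold HexAt at hH
  dsimp only [subst₂, t₄] at hH
  have h := congrArg (DrinfeldKohnoTrunc.permHom (R := k) (N := N) ρ₀₁₂) hH
  rw [map_mul, map_mul, map_mul, map_mul, map_ringInverse_of_isUnit _ hu] at h
  simp only [algHom_evalTrunc_bsub, DrinfeldKohnoTrunc.expT_eq_truncExp, map_truncExp,
    map_neg, map_smul, map_add, DrinfeldKohnoTrunc.permHom_t, ρ₀₁₂_0, ρ₀₁₂_1, ρ₀₁₂_2,
    DrinfeldKohnoTrunc.t_10, DrinfeldKohnoTrunc.t_20, smul_neg, neg_smul] at h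
  -- as an identity of units
  have hU : (expU μ ((𝔱 N) 0 1 + (𝔱 N) 0 2) m0102)⁻¹ =
      phiU N φ ((𝔱 N) 0 1) ((𝔱 N) 1 2) * (expU μ ((𝔱 N) 0 1) m01)⁻¹ *
        (phiU N φ ((𝔱 N) 0 1) ((𝔱 N) 0 2))⁻¹ * (expU μ ((𝔱 N) 0 2) m02)⁻¹ *
        phiU N φ ((𝔱 N) 1 2) ((𝔱 N) 0 2) := Units.ext (by
    simp only [Units.val_mul, expU_inv_val, phiU_inv_val h1 m01 m02, phiU_val h1 m01 m12,
      phiU_val h1 m12 m02, DrinfeldKohnoTrunc.expT_eq_truncExp]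
    exact h)
  have hU' := congrArg (fun z : (DrinfeldKohnoTrunc k (Fin 4) N)ˣ =>
    ((z⁻¹ : (DrinfeldKohnoTrunc k (Fin 4) N)ˣ) : DrinfeldKohnoTrunc k (Fin 4) N)) hU
  simp only [inv_inv, mul_inv_rev, Units.val_mul, expU_val, phiU_inv_val h1 m01 m12,
    phiU_inv_val h1 m12 m02, phiU_val h1 m01 m02, mul_assoc] at hU'
  unfold HexBAt
  dsimp only [subst₂, t₄]
  simpa only [mul_assoc] using hU'

/-- **Pentagon ⇒ both hexagons, over a commutative `ℚ`-algebra** [Furusho2010, Thm 1]: a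
group-like solution `φ` of the pentagon satisfies both hexagon equations with every `μ` such that
`μ² = 24 c_{X₀X₁}(φ)`. [cite: Furusho2010, Thm 1] -/
theorem drinfeldHexagons_of_pentagon {φ : NCSeries Bool k} (hg : IsGroupLike φ)
    (hP : DrinfeldPentagon φ) {μ : k} (hμ : μ ^ 2 = 24 * φ [false, true]) :
    DrinfeldHexagon μ φ ∧ DrinfeldHexagonB μ φ := by
  have hA : ∀ N, HexAt μ φ N := hexAt_of_pentagon hg hP hμ
  have hA' : ∀ N, HexAt (-μ) φ N := hexAt_of_pentagon hg hP (by rw [neg_sq]; exact hμ)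
  exact ⟨fun N => hA N, fun N => hexBAt_of_hexAt_neg hg.1 (hA' N)⟩

end Induction

end NCSeries

/-- **[Furusho2010, Thm 1]: the pentagon equation implies the hexagon equations.** Let `φ` be a
group-like element of `U𝔉₂ = k⟨⟨X₀,X₁⟩⟩` (`k` a field of characteristic `0`) satisfying Drinfeld's
pentagon equation; then with `μ = ±(24 c₂(φ))^{1/2} ∈ k̄` the pair `(μ, φ)` satisfies the two
hexagon equations. This discharges the named fact `furusho_pentagon_hexagon`
(`Associators.lean`). [cite: Furusho2010, Thm 1] -/
theorem furusho_pentagon_hexagon_holds : furusho_pentagon_hexagon := by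
  intro k _ _ φ hg hP
  haveI : CharZero (AlgebraicClosure k) :=
    charZero_of_injective_algebraMap (algebraMap k (AlgebraicClosure k)).injective
  obtain ⟨μ, hμ⟩ := IsAlgClosed.exists_pow_nat_eq
    (24 * algebraMap k (AlgebraicClosure k) (φ [false, true])) (by norm_num : 0 < 2)
  have hgK : NCSeries.IsGroupLike (NCSeries.map (algebraMap k (AlgebraicClosure k)) φ) := hg.map _
  have hPK : NCSeries.DrinfeldPentagon (NCSeries.map (algebraMap k (AlgebraicClosure k)) φ) := hP.map _
  have hμ' : μ ^ 2 = 24 * (NCSeries.map (algebraMap k (AlgebraicClosure k)) φ) [false, true] := by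
    rw [NCSeries.map_apply]; exact hμ
  obtain ⟨hH, hHB⟩ := NCSeries.drinfeldHexagons_of_pentagon hgK hPK hμ'
  exact ⟨μ, hμ, hH, hHB⟩

end Literature.NumberTheory.Transcendental
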